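import Mathlib
import Summits.KontsevichZagierPeriods.Zeta5Search.Families.ConstantTermTypes
import HarnessLib

/-!
# ζ(5) search — Families: the RATE of the constant terms `CT[Λⁿ]`, `Λ = N/X^B` — Fekete and the critical-point identity (p3 g8)

HONEST FRAMING: systematic search; no irrationality claim unless certified.  Elementary real analysis; nothing in this
file mentions a zeta value and no number of record moves.

OUR work (Summit side; cell `pub-zeta5`, prover seat p3, generation 8).  Sequel of `Families/ConstantTermTypes`.  For an
`MvPolynomial` `N` over `ℝ` with non-negative coefficients, an exponent `B` with `coeff B N > 0`, and a point `g` of the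
open positive orthant:
* `ctPow N B n = coeff (n•B) (Nⁿ)` (the constant term of `Λⁿ`), `ctPow_pos`, `ctPow_supermul`, `ctPow_le` (`≤ Λ(g)ⁿ`,
  `lamVal N B g = N(g)/g^B`), and by Fekete (`Subadditive.tendsto_lim`) **`tendsto_log_ctPow_div`**: `log CT[Λⁿ]/n → ctRate N B`,
  the supremum of the sequence (`log_ctPow_div_le_ctRate`), with **`ctRate_le`**: `ctRate ≤ log Λ(g)` for every `g > 0`;
* the TILTED distribution `tilt N g k = c_k g^k/N(g)` on the monomials (`tilt_pos`, `sum_tilt`), and at a CRITICAL point of `Λ`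
  (`Σ_k c_k g^k k_i = B_i N(g)` for all `i`, i.e. `g_i ∂_i N = B_i N`): the mean is `B` (`sum_tilt_mul_eq`) and the ENTROPY
  IDENTITY **`sum_tilt_log_eq`**: `Σ_k μ_k log(c_k/μ_k) = log Λ(g)`.
The lower bound `ctRate ≥ log Λ(g)` at a critical point (rounding types + bounded defect repair) is the sequel
`ConstantTermTypesRate`.  Intended use: cert-2's CONJECTURE D (`Families/DualConstantTerm`) with `N = dualSpanProd (bzNum a)`.
Standard axioms only.
-/

noncomputable section

open MvPolynomial Finset Real Filter Topology

namespace Summit.KontsevichZagierPeriods.Zeta5Search.Families.CTTypes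

variable {σ : Type*} [DecidableEq σ]

/-! ## The constant terms of `Λⁿ` -/

/-- `CT[Λⁿ] = coeff (n • B) (Nⁿ)` for `Λ = N / X^B`. -/
def ctPow (N : MvPolynomial σ ℝ) (B : σ →₀ ℕ) (n : ℕ) : ℝ := (N ^ n).coeff (n • B)

/-- Super-multiplicativity `CT[Λᵐ]·CT[Λⁿ] ≤ CT[Λᵐ⁺ⁿ]`. -/
theorem ctPow_supermul {N : MvPolynomial σ ℝ} (hN : ∀ m, 0 ≤ N.coeff m) (B : σ →₀ ℕ) (m n : ℕ) :
    ctPow N B m * ctPow N B n ≤ ctPow N B (m + n) := by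
  unfold ctPow
  rw [add_nsmul]
  exact coeff_pow_supermul hN m n _ _

/-- `CT[Λ]ⁿ ≤ CT[Λⁿ]`. -/
theorem pow_le_ctPow {N : MvPolynomial σ ℝ} (hN : ∀ m, 0 ≤ N.coeff m) {B : σ →₀ ℕ} (hB : 0 < N.coeff B) (n : ℕ) :
    N.coeff B ^ n ≤ ctPow N B n := by
  induction n with
  | zero => simp [ctPow]
  | succ n ih =>
    calc N.coeff B ^ (n + 1) = N.coeff B ^ n * N.coeff B := pow_succ _ _
      _ ≤ ctPow N B n * ctPow N B 1 := by
          refine mul_le_mul ih (by simp [ctPow]) hB.le ?_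
          exact le_trans (pow_nonneg hB.le n) ih
      _ ≤ ctPow N B (n + 1) := ctPow_supermul hN B n 1

/-- `CT[Λⁿ] > 0` when `coeff B N > 0`. -/
theorem ctPow_pos {N : MvPolynomial σ ℝ} (hN : ∀ m, 0 ≤ N.coeff m) {B : σ →₀ ℕ} (hB : 0 < N.coeff B) (n : ℕ) :
    0 < ctPow N B n :=
  lt_of_lt_of_le (pow_pos hB n) (pow_le_ctPow hN hB n)

omit [DecidableEq σ] in
/-- `g^e > 0` on the open orthant. -/
theorem monoVal_pos {g : σ → ℝ} (hg : ∀ i, 0 < g i) (e : σ →₀ ℕ) : 0 < monoVal g e := by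
  unfold monoVal Finsupp.prod
  exact Finset.prod_pos fun i _ => pow_pos (hg i) _

/-- The value `Λ(g) = N(g) / g^B`. -/
def lamVal (N : MvPolynomial σ ℝ) (B : σ →₀ ℕ) (g : σ → ℝ) : ℝ := eval g N / monoVal g B

omit [DecidableEq σ] in
/-- **Upper bound** `CT[Λⁿ] ≤ Λ(g)ⁿ` for `g` in the open orthant. -/
theorem ctPow_le {N : MvPolynomial σ ℝ} (hN : ∀ m, 0 ≤ N.coeff m) {g : σ → ℝ} (hg : ∀ i, 0 < g i) (B : σ →₀ ℕ) (n : ℕ) :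
    ctPow N B n ≤ lamVal N B g ^ n := by
  have h := coeff_pow_mul_monoVal_le hN (fun i => (hg i).le) n (n • B)
  rw [monoVal_nsmul] at h
  have hpos : 0 < monoVal g B ^ n := pow_pos (monoVal_pos hg B) n
  rw [lamVal, div_pow, le_div_iff₀ hpos]
  exact h

/-- `Λ(g) > 0`. -/
theorem lamVal_pos {N : MvPolynomial σ ℝ} (hN : ∀ m, 0 ≤ N.coeff m) {B : σ →₀ ℕ} (hB : 0 < N.coeff B) {g : σ → ℝ}
    (hg : ∀ i, 0 < g i) : 0 < lamVal N B g := by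
  have h := ctPow_le hN hg B 1
  rw [pow_one] at h
  exact lt_of_lt_of_le (ctPow_pos hN hB 1) h

/-! ## Fekete: the rate exists and is the supremum -/

/-- The subadditive sequence `u n = −log CT[Λⁿ]`. -/
def negLogCt (N : MvPolynomial σ ℝ) (B : σ →₀ ℕ) (n : ℕ) : ℝ := -Real.log (ctPow N B n)

/-- `−log CT[Λⁿ]` is subadditive. -/
theorem subadditive_negLogCt {N : MvPolynomial σ ℝ} (hN : ∀ m, 0 ≤ N.coeff m) {B : σ →₀ ℕ} (hB : 0 < N.coeff B) :
    Subadditive (negLogCt N B) := by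
  intro m n
  unfold negLogCt
  have hm := ctPow_pos hN hB m
  have hn := ctPow_pos hN hB n
  have h := Real.log_le_log (mul_pos hm hn) (ctPow_supermul hN B m n)
  rw [Real.log_mul hm.ne' hn.ne'] at h
  linarith

/-- `−log CT[Λⁿ]/n ≥ min(−log Λ(g), 0)`: the Fekete sequence is bounded below. -/
theorem bddBelow_negLogCt_div {N : MvPolynomial σ ℝ} (hN : ∀ m, 0 ≤ N.coeff m) {B : σ →₀ ℕ} (hB : 0 < N.coeff B)
    {g : σ → ℝ} (hg : ∀ i, 0 < g i) : BddBelow (Set.range fun n : ℕ => negLogCt N B n / n) := by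
  refine ⟨min (-Real.log (lamVal N B g)) 0, ?_⟩
  rintro _ ⟨n, rfl⟩
  rcases Nat.eq_zero_or_pos n with rfl | hn
  · simp [negLogCt, ctPow]
  have hnr : (0 : ℝ) < n := by exact_mod_cast hn
  refine le_trans (min_le_left _ _) ?_
  rw [le_div_iff₀ hnr, negLogCt]
  have h := Real.log_le_log (ctPow_pos hN hB n) (ctPow_le hN hg B n)
  rw [Real.log_pow] at h
  linarith

/-- **The rate** `ctRate = lim log CT[Λⁿ]/n` (minus the Fekete infimum of `−log CT[Λⁿ]/n` over `n ≥ 1`). -/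
def ctRate (N : MvPolynomial σ ℝ) (B : σ →₀ ℕ) : ℝ := -sInf ((fun n : ℕ => negLogCt N B n / n) '' Set.Ici 1)

/-- **Fekete**: `log CT[Λⁿ]/n → ctRate` (given some point of the open orthant, which bounds the sequence). -/
theorem tendsto_log_ctPow_div {N : MvPolynomial σ ℝ} (hN : ∀ m, 0 ≤ N.coeff m) {B : σ →₀ ℕ} (hB : 0 < N.coeff B)
    {g : σ → ℝ} (hg : ∀ i, 0 < g i) :
    Tendsto (fun n : ℕ => Real.log (ctPow N B n) / n) atTop (𝓝 (ctRate N B)) := by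
  have h := (subadditive_negLogCt hN hB).tendsto_lim (bddBelow_negLogCt_div hN hB hg)
  have h2 := h.neg
  have h3 : ctRate N B = -(subadditive_negLogCt hN hB).lim := by rw [ctRate, Subadditive.lim]
  rw [h3]
  refine (tendsto_congr fun n => ?_).1 h2
  simp [negLogCt, neg_div]

/-- Every term is below the rate: `log CT[Λⁿ]/n ≤ ctRate` (`n ≥ 1`). -/
theorem log_ctPow_div_le_ctRate {N : MvPolynomial σ ℝ} (hN : ∀ m, 0 ≤ N.coeff m) {B : σ →₀ ℕ} (hB : 0 < N.coeff B)
    {g : σ → ℝ} (hg : ∀ i, 0 < g i) {n : ℕ} (hn : n ≠ 0) :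
    Real.log (ctPow N B n) / n ≤ ctRate N B := by
  have h : (subadditive_negLogCt hN hB).lim ≤ negLogCt N B n / n :=
    (subadditive_negLogCt hN hB).lim_le_div (bddBelow_negLogCt_div hN hB hg) hn
  have h3 : ctRate N B = -(subadditive_negLogCt hN hB).lim := by rw [ctRate, Subadditive.lim]
  rw [h3]
  rw [negLogCt, neg_div] at h
  linarith

/-- **`ctRate ≤ log Λ(g)`** for every `g` in the open orthant. -/
theorem ctRate_le {N : MvPolynomial σ ℝ} (hN : ∀ m, 0 ≤ N.coeff m) {B : σ →₀ ℕ} (hB : 0 < N.coeff B)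
    {g : σ → ℝ} (hg : ∀ i, 0 < g i) : ctRate N B ≤ Real.log (lamVal N B g) := by
  refine le_of_tendsto (tendsto_log_ctPow_div hN hB hg) (Filter.eventually_atTop.2 ⟨1, fun n hn => ?_⟩)
  have hnr : (0 : ℝ) < n := by exact_mod_cast hn
  rw [div_le_iff₀ hnr]
  have h := Real.log_le_log (ctPow_pos hN hB n) (ctPow_le hN hg B n)
  rw [Real.log_pow] at h
  linarith

/-! ## The tilted distribution at a point of the orthant -/

/-- The tilted weights `μ_k = c_k g^k / N(g)` on the monomials of `N`. -/
def tilt (N : MvPolynomial σ ℝ) (g : σ → ℝ) (k : σ →₀ ℕ) : ℝ := N.coeff k * monoVal g k / eval g N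

omit [DecidableEq σ] in
/-- `N(g) = Σ_{k ∈ support} c_k g^k`. -/
theorem eval_eq_sum_monoVal (N : MvPolynomial σ ℝ) (g : σ → ℝ) :
    eval g N = ∑ k ∈ N.support, N.coeff k * monoVal g k := by
  rw [eval_eq]
  rfl

omit [DecidableEq σ] in
/-- `N(g) > 0` on the open orthant (when `coeff B N > 0`). -/
theorem eval_pos_of_coeff_pos {N : MvPolynomial σ ℝ} (hN : ∀ m, 0 ≤ N.coeff m) {B : σ →₀ ℕ} (hB : 0 < N.coeff B)
    {g : σ → ℝ} (hg : ∀ i, 0 < g i) : 0 < eval g N := by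
  have h := coeff_mul_monoVal_le_eval hN (fun i => (hg i).le) B
  exact lt_of_lt_of_le (mul_pos hB (monoVal_pos hg B)) h

omit [DecidableEq σ] in
/-- The tilted weights are positive on the support. -/
theorem tilt_pos {N : MvPolynomial σ ℝ} (hN : ∀ m, 0 ≤ N.coeff m) {B : σ →₀ ℕ} (hB : 0 < N.coeff B)
    {g : σ → ℝ} (hg : ∀ i, 0 < g i) {k : σ →₀ ℕ} (hk : k ∈ N.support) : 0 < tilt N g k := by
  unfold tilt
  have hc : 0 < N.coeff k := lt_of_le_of_ne (hN k) (fun h => (mem_support_iff.1 hk) h.symm)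
  exact div_pos (mul_pos hc (monoVal_pos hg k)) (eval_pos_of_coeff_pos hN hB hg)

omit [DecidableEq σ] in
/-- The tilted weights sum to `1`. -/
theorem sum_tilt {N : MvPolynomial σ ℝ} (hN : ∀ m, 0 ≤ N.coeff m) {B : σ →₀ ℕ} (hB : 0 < N.coeff B)
    {g : σ → ℝ} (hg : ∀ i, 0 < g i) : ∑ k ∈ N.support, tilt N g k = 1 := by
  unfold tilt
  rw [← Finset.sum_div, ← eval_eq_sum_monoVal, div_self (eval_pos_of_coeff_pos hN hB hg).ne']

omit [DecidableEq σ] in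
/-- At a CRITICAL point of `Λ = N/X^B` (`Σ_k c_k g^k k_i = B_i N(g)` for all `i`) the tilted mean is `B`:
`Σ_k μ_k k_i = B_i`. -/
theorem sum_tilt_mul_eq {N : MvPolynomial σ ℝ} (hN : ∀ m, 0 ≤ N.coeff m) {B : σ →₀ ℕ} (hB : 0 < N.coeff B)
    {g : σ → ℝ} (hg : ∀ i, 0 < g i)
    (hcrit : ∀ i, ∑ k ∈ N.support, N.coeff k * monoVal g k * (k i : ℝ) = (B i : ℝ) * eval g N) (i : σ) :
    ∑ k ∈ N.support, tilt N g k * (k i : ℝ) = B i := by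
  have hE := eval_pos_of_coeff_pos hN hB hg
  have h := hcrit i
  unfold tilt
  have : ∑ k ∈ N.support, N.coeff k * monoVal g k / eval g N * (k i : ℝ) =
      (∑ k ∈ N.support, N.coeff k * monoVal g k * (k i : ℝ)) / eval g N := by
    rw [Finset.sum_div]
    refine Finset.sum_congr rfl fun k _ => ?_
    ring
  rw [this, h, mul_div_assoc, div_self hE.ne', mul_one]

omit [DecidableEq σ] in
/-- `log g^k = Σ_i k_i log g_i` on the open orthant. -/
theorem log_monoVal [Fintype σ] {g : σ → ℝ} (hg : ∀ i, 0 < g i) (k : σ →₀ ℕ) :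
    Real.log (monoVal g k) = ∑ i, (k i : ℝ) * Real.log (g i) := by
  unfold monoVal
  rw [Finsupp.prod_fintype _ _ (fun i => pow_zero _), Real.log_prod (s := Finset.univ) (fun i _ => (pow_pos (hg i) _).ne')]
  refine Finset.sum_congr rfl fun i _ => ?_
  rw [Real.log_pow]

omit [DecidableEq σ] in
/-- **The entropy identity at a critical point**: `Σ_k μ_k log(c_k/μ_k) = log Λ(g)`. -/
theorem sum_tilt_log_eq [Fintype σ] {N : MvPolynomial σ ℝ} (hN : ∀ m, 0 ≤ N.coeff m) {B : σ →₀ ℕ} (hB : 0 < N.coeff B)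
    {g : σ → ℝ} (hg : ∀ i, 0 < g i)
    (hcrit : ∀ i, ∑ k ∈ N.support, N.coeff k * monoVal g k * (k i : ℝ) = (B i : ℝ) * eval g N) :
    ∑ k ∈ N.support, tilt N g k * Real.log (N.coeff k / tilt N g k) = Real.log (lamVal N B g) := by
  have hE := eval_pos_of_coeff_pos hN hB hg
  -- `c_k / μ_k = N(g) / g^k`
  have hq : ∀ k ∈ N.support, Real.log (N.coeff k / tilt N g k) = Real.log (eval g N) - ∑ i, (k i : ℝ) * Real.log (g i) := by
    intro k hk
    have hc : 0 < N.coeff k := lt_of_le_of_ne (hN k) (fun h => (mem_support_iff.1 hk) h.symm)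
    have hm := monoVal_pos hg k
    have : N.coeff k / tilt N g k = eval g N / monoVal g k := by
      unfold tilt
      field_simp
    rw [this, Real.log_div hE.ne' hm.ne', log_monoVal hg]
  have step1 : ∑ k ∈ N.support, tilt N g k * Real.log (N.coeff k / tilt N g k) =
      ∑ k ∈ N.support, (tilt N g k * Real.log (eval g N) - ∑ i, tilt N g k * (k i : ℝ) * Real.log (g i)) := by
    refine Finset.sum_congr rfl fun k hk => ?_
    rw [hq k hk, mul_sub, Finset.mul_sum]
    refine congrArg _ (Finset.sum_congr rfl fun i _ => ?_)
    ring
  have step2 : ∑ k ∈ N.support, (∑ i, tilt N g k * (k i : ℝ) * Real.log (g i)) = ∑ i, (B i : ℝ) * Real.log (g i) := by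
    rw [Finset.sum_comm]
    refine Finset.sum_congr rfl fun i _ => ?_
    rw [← sum_tilt_mul_eq hN hB hg hcrit i, Finset.sum_mul]
  rw [step1, Finset.sum_sub_distrib, ← Finset.sum_mul, sum_tilt hN hB hg, one_mul, step2, lamVal,
    Real.log_div hE.ne' (monoVal_pos hg B).ne', log_monoVal hg B]

end Summit.KontsevichZagierPeriods.Zeta5Search.Families.CTTypes
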